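import Mathlib.Algebra.BigOperators.Field
import Mathlib.Algebra.BigOperators.Intervals
import Mathlib.Algebra.Order.BigOperators.Group.Finset
import Mathlib.Order.Interval.Finset.Nat
import Mathlib.Data.Nat.Choose.Basic
import Mathlib.Data.Nat.Factorial.BigOperators
import Mathlib.Tactic.FieldSimp
import Mathlib.Tactic.Ring
import Mathlib.Tactic.Linarith
import Mathlib.Tactic.LinearCombination
import Literature.NumberTheory.DiophantineGeometry.StandardFillings
import HarnessLib

/-!
# The hook length formula (Frame–Robinson–Thrall): proof of
`numStandardTableaux_mul_prod_hookLength`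

This file discharges the named fact `numStandardTableaux_mul_prod_hookLength` of
`PartitionTableaux` (Frame–Robinson–Thrall 1954, Theorem 1): for every partition `μ ⊢ d`,
`f^μ · ∏_{c ∈ μ} h(c) = d!`, where `f^μ = numStandardTableaux μ` is the number of standard
Young tableaux of shape `μ` and `h(c)` the hook length of the box `c`
(`numStandardTableaux_mul_prod_hookLength_holds`). More generally
`card_stdFilling_mul_prod_hookLength` proves `#SYT(Y) · ∏_{c ∈ Y} h(c) = |Y|!` for every
Young diagram `Y`.

## The proof (FRT 1954, §2, made self-contained)

Frame–Robinson–Thrall derive Theorem 1 from two ingredients, both proved here.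

* **FRT Lemma 1 / formula (2.1)** (`prod_hookLength_row_mul_prod_sub`): with the `β`-numbers
  `β_i = λ_i + (N - 1 - i)` (`0`-indexed rows `i < N`; these are the first-column hook lengths of
  the diagram padded to `N` rows), the hook lengths of row `i` together with the differences
  `β_i - β_s` (`i < s < N`) form a permutation of `1, …, β_i`, so that
  `∏_{j} h(i, j) · ∏_{s > i} (β_i - β_s) = β_i!`, and over all rows
  `H(Y) · Φ(β) = ∏_i β_i!` with `Φ(β) = ∏_{i < s} (β_i - β_s)`
  (`prod_hookLength_mul_prod_prod_sub`).
* **The Frobenius–Young degree formula (2.2)** `f^λ · ∏_i β_i! = n! · Φ(β)`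
  (`card_stdFilling_mul_prod_factorial`), which FRT quote from Frobenius and Young. Since `f^λ`
  is *defined* here as the number of standard Young tableaux, we prove (2.2) by induction on
  `n` from the branching rule `f^λ = ∑_{corners} f^{λ⁻}`
  (`card_stdFilling_succ_eq_sum_corners`, from `StdFilling.card_stdFilling_succ`) and the
  rational-function identity
  `∑_r x_r ∏_{l ≠ r} (x_r - x_l - 1)/(x_r - x_l) = ∑_r x_r - (N choose 2)`
  (`sum_mul_prod_sub_sub_one_div_sub_eq`; the case `t = -1`, divided by `Δ`, of the Vandermonde
  identity of Fulton §4.3 Ex. 10), obtained from the partial fraction expansion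
  `∏_l (t - x_l - 1)/(t - x_l) = 1 - ∑_j A_j/(t - x_j)` (`prod_sub_sub_one_div_sub_eq`) by
  induction on the number of variables. Non-corner rows contribute vanishing terms, and
  `Φ(β - e_r) = A_r Φ(β)` (`prod_prod_update_sub_one_eq`).

Dividing `f · H · Φ = f · ∏ β_i! = n! · Φ` by `Φ ≠ 0` gives Theorem 1.

## Sources

* J. S. Frame, G. de B. Robinson, R. M. Thrall, *The hook graphs of the symmetric group*,
  Canad. J. Math. **6** (1954), 316–324: Lemma 1, (2.1)–(2.4), Theorem 1 (pp. 317–318).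
  [cite: FrameRobinsonThrallCJM1954, Theorem 1]
* W. Fulton, *Young Tableaux*, LMS Student Texts 35 (1997), §4.3, pp. 53–54: formula (8)
  (branching of `f^λ`), Exercise 9 (the Frobenius–Young form of the hook length formula) and
  Exercise 10 (the inductive proof via `∑ x_i Δ(…, x_i + t, …) = (∑ x_i + (k choose 2) t) Δ`);
  this file follows exactly that route.
* D. E. Knuth, *The Art of Computer Programming*, vol. 3, §5.1.4, Theorem H (the same route).

## Mathlib

Uses `YoungDiagram` (`rowLen`, `colLen`, `row_eq_prod`, `rowLen_anti`, `colLen_anti`),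
`Finset.prod_fiberwise_of_maps_to`, `Finset.prod_image`, `Finset.eq_of_subset_of_card_le`,
`Finset.prod_Ico_id_eq_factorial`, `Finset.sum_range_reflect`, `Finset.sum_range_id`,
`Function.update`, `field_simp`/`linear_combination`. Mathlib (this pin) has no hook lengths,
standard Young tableaux or hook length formula; `StdFilling` and its branching rule are H21's
(`StandardFillings`).

## Design

* Everything is stated for a general `YoungDiagram` `Y` together with a row bound `N`
  (`∀ c ∈ Y.cells, c.1 < N`), the `β`-numbers being written out as `Y.rowLen i + (N - 1 - i)`;
  the `ℕ`-subtractions `N - 1 - i` (`i < N`) and `β_i - β_s` (`i < s`, `β` strictly decreasing,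
  `rowLen_add_lt_rowLen_add`) never truncate where they are used.
* The algebraic identities are proved over an arbitrary field for a family `x` injective on a
  finset; the degree formula is then an identity in `ℚ` and the final cancellation of `Φ ≠ 0`
  returns to `ℕ` by `Nat.cast` injectivity.
* No new definitions are introduced (proof-only companion of `PartitionTableaux`).
-/

open scoped BigOperators

namespace Literature.NumberTheory.DiophantineGeometry

section Algebra

variable {K : Type*} [Field K] {ι : Type*} [DecidableEq ι]

/-- **Partial fractions of `∏ (t - x_l - 1)/(t - x_l)`.** For distinct `x_l` (`l ∈ s`) and
`t ∉ {x_l}`: `∏_{l ∈ s} (t - x_l - 1)/(t - x_l) = 1 - ∑_{j ∈ s} A_j / (t - x_j)` with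
`A_j = ∏_{l ∈ s, l ≠ j} (x_j - x_l - 1)/(x_j - x_l)` (Lagrange interpolation at the nodes
`x_j`). [folklore] -/
theorem prod_sub_sub_one_div_sub_eq (s : Finset ι) (x : ι → K) (hx : Set.InjOn x s) (t : K)
    (ht : ∀ l ∈ s, t ≠ x l) :
    ∏ l ∈ s, (t - x l - 1) / (t - x l) =
      1 - ∑ j ∈ s, (∏ l ∈ s.erase j, (x j - x l - 1) / (x j - x l)) / (t - x j) := by
  induction s using Finset.induction_on generalizing t with
  | empty => simp
  | @insert a s ha ih =>
    have hxs : Set.InjOn x s := hx.mono (Finset.coe_subset.2 (Finset.subset_insert a s))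
    have hta : t - x a ≠ 0 := sub_ne_zero.2 (ht a (Finset.mem_insert_self a s))
    have hts : ∀ l ∈ s, t ≠ x l := fun l hl => ht l (Finset.mem_insert_of_mem hl)
    have has : ∀ l ∈ s, x a ≠ x l := fun l hl h =>
      ha ((hx (Finset.mem_insert_self a s) (Finset.mem_insert_of_mem hl) h) ▸ hl)
    rw [Finset.prod_insert ha, Finset.sum_insert ha, Finset.erase_insert ha, ih hxs t hts,
      ih hxs (x a) has]
    have hsum : ∀ j ∈ s,
        (∏ l ∈ (insert a s).erase j, (x j - x l - 1) / (x j - x l)) / (t - x j) =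
          (x j - x a - 1) / (x j - x a) *
            (∏ l ∈ s.erase j, (x j - x l - 1) / (x j - x l)) / (t - x j) := by
      intro j hj
      have hja : a ≠ j := fun h => ha (h ▸ hj)
      rw [Finset.erase_insert_of_ne hja,
        Finset.prod_insert (fun h => ha (Finset.mem_of_mem_erase h))]
    rw [Finset.sum_congr rfl hsum]
    set A : ι → K := fun j => ∏ l ∈ s.erase j, (x j - x l - 1) / (x j - x l) with hA
    have key : ∀ j ∈ s, (t - x a - 1) / (t - x a) * (A j / (t - x j)) =
        -((A j / (x a - x j)) / (t - x a)) + (x j - x a - 1) / (x j - x a) * A j / (t - x j) := by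
      intro j hj
      have h1 : t - x j ≠ 0 := sub_ne_zero.2 (hts j hj)
      have h2 : x a - x j ≠ 0 := sub_ne_zero.2 (has j hj)
      have h3 : x j - x a ≠ 0 := sub_ne_zero.2 (has j hj).symm
      field_simp
      ring
    calc (t - x a - 1) / (t - x a) * (1 - ∑ j ∈ s, A j / (t - x j))
        = (t - x a - 1) / (t - x a) -
            ∑ j ∈ s, (t - x a - 1) / (t - x a) * (A j / (t - x j)) := by
          rw [mul_sub, mul_one, Finset.mul_sum]
      _ = (t - x a - 1) / (t - x a) - ∑ j ∈ s, (-((A j / (x a - x j)) / (t - x a)) +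
            (x j - x a - 1) / (x j - x a) * A j / (t - x j)) := by
          rw [Finset.sum_congr rfl key]
      _ = 1 - ((1 - ∑ j ∈ s, A j / (x a - x j)) / (t - x a) +
            ∑ j ∈ s, (x j - x a - 1) / (x j - x a) * A j / (t - x j)) := by
          rw [Finset.sum_add_distrib, Finset.sum_neg_distrib, ← Finset.sum_div]
          field_simp
          ring

/-- **`∑_j A_j = |s|`** for `A_j = ∏_{l ≠ j} (x_j - x_l - 1)/(x_j - x_l)`, `x` injective on
`s`
(the `t^{|s|-1}`-coefficient of the partial fraction identity; Macdonald, *Symmetric functions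
and Hall polynomials*, I, §1, Ex. 1 style identity). [folklore] -/
theorem sum_prod_sub_sub_one_div_sub_eq_card (s : Finset ι) (x : ι → K) (hx : Set.InjOn x s) :
    ∑ j ∈ s, ∏ l ∈ s.erase j, (x j - x l - 1) / (x j - x l) = s.card := by
  induction s using Finset.induction_on with
  | empty => simp
  | @insert a s ha ih =>
    have hxs : Set.InjOn x s := hx.mono (Finset.coe_subset.2 (Finset.subset_insert a s))
    have has : ∀ l ∈ s, x a ≠ x l := fun l hl h =>
      ha ((hx (Finset.mem_insert_self a s) (Finset.mem_insert_of_mem hl) h) ▸ hl)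
    rw [Finset.sum_insert ha, Finset.erase_insert ha,
      prod_sub_sub_one_div_sub_eq s x hxs (x a) has, Finset.card_insert_of_notMem ha]
    have hsum : ∀ j ∈ s,
        (∏ l ∈ (insert a s).erase j, (x j - x l - 1) / (x j - x l)) =
          (∏ l ∈ s.erase j, (x j - x l - 1) / (x j - x l)) +
            (∏ l ∈ s.erase j, (x j - x l - 1) / (x j - x l)) / (x a - x j) := by
      intro j hj
      have hja : a ≠ j := fun h => ha (h ▸ hj)
      rw [Finset.erase_insert_of_ne hja,
        Finset.prod_insert (fun h => ha (Finset.mem_of_mem_erase h))]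
      have h2 : x a - x j ≠ 0 := sub_ne_zero.2 (has j hj)
      have h3 : x j - x a ≠ 0 := sub_ne_zero.2 (has j hj).symm
      field_simp
      ring
    rw [Finset.sum_congr rfl hsum, Finset.sum_add_distrib, ih hxs]
    push_cast
    ring

/-- **`∑_j x_j A_j = ∑_j x_j - (|s| choose 2)`** for
`A_j = ∏_{l ≠ j} (x_j - x_l - 1)/(x_j - x_l)`,
`x` injective on `s`: the rational-function identity behind the recursion for the
Frobenius–Young degree formula (Fulton, *Young Tableaux*, §4.3 Ex. 10, case `t = -1` divided by
`Δ`; Knuth, TAOCP 3, §5.1.4, proof of Theorem H). [folklore] -/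
theorem sum_mul_prod_sub_sub_one_div_sub_eq (s : Finset ι) (x : ι → K) (hx : Set.InjOn x s) :
    ∑ j ∈ s, x j * ∏ l ∈ s.erase j, (x j - x l - 1) / (x j - x l) =
      ∑ j ∈ s, x j - (s.card.choose 2 : ℕ) := by
  induction s using Finset.induction_on with
  | empty => simp
  | @insert a s ha ih =>
    have hxs : Set.InjOn x s := hx.mono (Finset.coe_subset.2 (Finset.subset_insert a s))
    have has : ∀ l ∈ s, x a ≠ x l := fun l hl h =>
      ha ((hx (Finset.mem_insert_self a s) (Finset.mem_insert_of_mem hl) h) ▸ hl)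
    rw [Finset.sum_insert ha, Finset.sum_insert ha, Finset.erase_insert ha,
      prod_sub_sub_one_div_sub_eq s x hxs (x a) has, Finset.card_insert_of_notMem ha,
      Nat.choose_succ_succ', Nat.choose_one_right]
    have hsum : ∀ j ∈ s,
        x j * (∏ l ∈ (insert a s).erase j, (x j - x l - 1) / (x j - x l)) =
          x j * (∏ l ∈ s.erase j, (x j - x l - 1) / (x j - x l)) +
            (x a * ((∏ l ∈ s.erase j, (x j - x l - 1) / (x j - x l)) / (x a - x j)) -
            ∏ l ∈ s.erase j, (x j - x l - 1) / (x j - x l)) := by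
      intro j hj
      have hja : a ≠ j := fun h => ha (h ▸ hj)
      rw [Finset.erase_insert_of_ne hja,
        Finset.prod_insert (fun h => ha (Finset.mem_of_mem_erase h))]
      have h2 : x a - x j ≠ 0 := sub_ne_zero.2 (has j hj)
      have h3 : x j - x a ≠ 0 := sub_ne_zero.2 (has j hj).symm
      field_simp
      ring
    rw [Finset.sum_congr rfl hsum, Finset.sum_add_distrib, Finset.sum_sub_distrib, ih hxs,
      sum_prod_sub_sub_one_div_sub_eq_card s x hxs, ← Finset.mul_sum]
    push_cast
    ring


/-! ### The discriminant-type product `Φ(x) = ∏_{i < j < N} (x_i - x_j)` under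
`x_r ↦ x_r - 1` -/

/-- Splitting the product over pairs `i < j < N` at an index `r < N` into the pairs through `r`
and the others. [folklore] -/
theorem prod_range_prod_Ioo_eq_split {M : Type*} [CommMonoid M] (f : ℕ → ℕ → M) {N r : ℕ}
    (hr : r < N) :
    ∏ i ∈ Finset.range N, ∏ j ∈ Finset.Ioo i N, f i j =
      (∏ j ∈ Finset.Ioo r N, f r j) * (∏ i ∈ Finset.range r, f i r) *
        ∏ i ∈ (Finset.range N).erase r, ∏ j ∈ (Finset.Ioo i N).erase r, f i j := by
  rw [← Finset.mul_prod_erase _ _ (Finset.mem_range.2 hr)]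
  have h1 : ∀ i ∈ (Finset.range N).erase r, ∏ j ∈ Finset.Ioo i N, f i j =
      (if i < r then f i r else 1) * ∏ j ∈ (Finset.Ioo i N).erase r, f i j := by
    intro i hi
    by_cases h : i < r
    · rw [if_pos h, Finset.mul_prod_erase _ _ (Finset.mem_Ioo.2 ⟨h, hr⟩)]
    · rw [if_neg h, one_mul, Finset.erase_eq_of_notMem]
      rw [Finset.mem_Ioo, not_and]
      exact fun h' => absurd h' h
  rw [Finset.prod_congr rfl h1, Finset.prod_mul_distrib, ← Finset.prod_filter]
  have h3 : ((Finset.range N).erase r).filter (fun i => i < r) = Finset.range r := by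
    ext i
    simp only [Finset.mem_filter, Finset.mem_erase, Finset.mem_range]
    omega
  rw [h3, mul_assoc]

/-- **`Φ(x - e_r) · ∏_{l ≠ r} (x_r - x_l) = Φ(x) · ∏_{l ≠ r} (x_r - x_l - 1)`** for
`Φ(x) = ∏_{i < j < N} (x_i - x_j)`: lowering `x_r` by one changes exactly the factors through
`r` (a polynomial identity, no distinctness needed). [folklore] -/
theorem prod_prod_update_sub_one_mul {R : Type*} [CommRing R] (x : ℕ → R) {N r : ℕ}
    (hr : r < N) :
    (∏ i ∈ Finset.range N, ∏ j ∈ Finset.Ioo i N,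
        (Function.update x r (x r - 1) i - Function.update x r (x r - 1) j)) *
      ∏ l ∈ (Finset.range N).erase r, (x r - x l) =
    (∏ i ∈ Finset.range N, ∏ j ∈ Finset.Ioo i N, (x i - x j)) *
      ∏ l ∈ (Finset.range N).erase r, (x r - x l - 1) := by
  rw [prod_range_prod_Ioo_eq_split _ hr, prod_range_prod_Ioo_eq_split (fun i j => x i - x j) hr]
  have hsplit : (Finset.range N).erase r = Finset.range r ∪ Finset.Ioo r N := by
    ext l
    simp only [Finset.mem_erase, Finset.mem_range, Finset.mem_union, Finset.mem_Ioo]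
    omega
  have hdisj : Disjoint (Finset.range r) (Finset.Ioo r N) := by
    rw [Finset.disjoint_left]
    intro l h1 h2
    rw [Finset.mem_range] at h1
    rw [Finset.mem_Ioo] at h2
    omega
  have h3 : ∏ i ∈ (Finset.range N).erase r, ∏ j ∈ (Finset.Ioo i N).erase r,
      (Function.update x r (x r - 1) i - Function.update x r (x r - 1) j) =
      ∏ i ∈ (Finset.range N).erase r, ∏ j ∈ (Finset.Ioo i N).erase r, (x i - x j) := by
    refine Finset.prod_congr rfl fun i hi => Finset.prod_congr rfl fun j hj => ?_
    rw [Function.update_of_ne (Finset.ne_of_mem_erase hi),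
      Function.update_of_ne (Finset.ne_of_mem_erase hj)]
  have h1 : ∏ j ∈ Finset.Ioo r N,
      (Function.update x r (x r - 1) r - Function.update x r (x r - 1) j) =
      ∏ j ∈ Finset.Ioo r N, (x r - x j - 1) := by
    refine Finset.prod_congr rfl fun j hj => ?_
    have hjr : j ≠ r := by
      rw [Finset.mem_Ioo] at hj
      omega
    rw [Function.update_self, Function.update_of_ne hjr]
    ring
  have h2 : ∏ i ∈ Finset.range r,
      (Function.update x r (x r - 1) i - Function.update x r (x r - 1) r) =
      ∏ i ∈ Finset.range r, (x i - x r + 1) := by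
    refine Finset.prod_congr rfl fun i hi => ?_
    have hir : i ≠ r := by
      rw [Finset.mem_range] at hi
      omega
    rw [Function.update_self, Function.update_of_ne hir]
    ring
  have h4 : (∏ i ∈ Finset.range r, (x i - x r + 1)) * ∏ l ∈ Finset.range r, (x r - x l) =
      (∏ i ∈ Finset.range r, (x i - x r)) * ∏ l ∈ Finset.range r, (x r - x l - 1) := by
    rw [← Finset.prod_mul_distrib, ← Finset.prod_mul_distrib]
    exact Finset.prod_congr rfl fun i _ => by ring
  have hQ : ∏ l ∈ (Finset.range N).erase r, (x r - x l) =
      (∏ l ∈ Finset.range r, (x r - x l)) * ∏ l ∈ Finset.Ioo r N, (x r - x l) := by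
    rw [hsplit, Finset.prod_union hdisj]
  have hR : ∏ l ∈ (Finset.range N).erase r, (x r - x l - 1) =
      (∏ l ∈ Finset.range r, (x r - x l - 1)) * ∏ l ∈ Finset.Ioo r N, (x r - x l - 1) := by
    rw [hsplit, Finset.prod_union hdisj]
  rw [h1, h2, h3, hQ, hR]
  linear_combination (∏ j ∈ Finset.Ioo r N, (x r - x j - 1)) *
    (∏ i ∈ (Finset.range N).erase r, ∏ j ∈ (Finset.Ioo i N).erase r, (x i - x j)) *
    (∏ l ∈ Finset.Ioo r N, (x r - x l)) * h4

/-- **`Φ(x - e_r) = A_r · Φ(x)`** with `A_r = ∏_{l ≠ r} (x_r - x_l - 1)/(x_r - x_l)`, for `x`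
injective on `{0, …, N-1}` and `Φ(x) = ∏_{i < j < N} (x_i - x_j)`. [folklore] -/
theorem prod_prod_update_sub_one_eq (x : ℕ → K) {N r : ℕ} (hr : r < N)
    (hx : Set.InjOn x (Finset.range N)) :
    ∏ i ∈ Finset.range N, ∏ j ∈ Finset.Ioo i N,
        (Function.update x r (x r - 1) i - Function.update x r (x r - 1) j) =
      (∏ l ∈ (Finset.range N).erase r, (x r - x l - 1) / (x r - x l)) *
        ∏ i ∈ Finset.range N, ∏ j ∈ Finset.Ioo i N, (x i - x j) := by
  have hne : ∏ l ∈ (Finset.range N).erase r, (x r - x l) ≠ 0 := by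
    rw [Finset.prod_ne_zero_iff]
    intro l hl
    obtain ⟨hlr, hlN⟩ := Finset.mem_erase.1 hl
    exact sub_ne_zero.2 fun h =>
      hlr (hx (Finset.mem_coe.2 hlN) (Finset.mem_coe.2 (Finset.mem_range.2 hr)) h.symm)
  rw [Finset.prod_div_distrib, div_mul_eq_mul_div, eq_div_iff hne,
    prod_prod_update_sub_one_mul x hr]
  ring

end Algebra

section RowHooks

open YoungDiagram

variable {Y : YoungDiagram} {N : ℕ}

/-- If every cell of `Y` lies in a row `< N`, then every column of `Y` has length `≤ N`.
[folklore] -/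
theorem colLen_le_of_forall_fst_lt (hN : ∀ c ∈ Y.cells, c.1 < N) (j : ℕ) :
    Y.colLen j ≤ N := by
  by_contra h
  have hmem : (N, j) ∈ Y := YoungDiagram.mem_iff_lt_colLen.2 (not_le.1 h)
  exact lt_irrefl _ (hN _ ((YoungDiagram.mem_cells _).2 hmem))

/-- The cells of a Young diagram with all rows `< N`, enumerated row by row:
`∏_{c ∈ Y} f(c) = ∏_{i < N} ∏_{j < λ_i} f(i, j)`. [folklore] -/
theorem prod_cells_eq_prod_range_rowLen {M : Type*} [CommMonoid M]
    (hN : ∀ c ∈ Y.cells, c.1 < N) (f : ℕ × ℕ → M) :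
    ∏ c ∈ Y.cells, f c =
      ∏ i ∈ Finset.range N, ∏ j ∈ Finset.range (Y.rowLen i), f (i, j) := by
  rw [← Finset.prod_fiberwise_of_maps_to (g := Prod.fst) (t := Finset.range N)
    (fun c hc => Finset.mem_range.2 (hN c hc))]
  refine Finset.prod_congr rfl fun i _ => ?_
  have hrow : (Y.cells.filter fun c => c.1 = i) = Y.row i := rfl
  rw [hrow, YoungDiagram.row_eq_prod, Finset.prod_product, Finset.prod_singleton]

/-- The number of cells of a Young diagram with all rows `< N` is `∑_{i < N} λ_i`. [folklore] -/
theorem card_cells_eq_sum_range_rowLen (hN : ∀ c ∈ Y.cells, c.1 < N) :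
    Y.cells.card = ∑ i ∈ Finset.range N, Y.rowLen i := by
  rw [Finset.card_eq_sum_ones, ← Finset.sum_fiberwise_of_maps_to (g := Prod.fst)
    (t := Finset.range N) (fun c hc => Finset.mem_range.2 (hN c hc))]
  refine Finset.sum_congr rfl fun i _ => ?_
  rw [← Finset.card_eq_sum_ones]
  exact Y.rowLen_eq_card.symm

/-- **Frame–Robinson–Thrall, Lemma 1 / formula (2.1)** (row version, `0`-indexed, with the
`β`-numbers `β_i = λ_i + (N - 1 - i)` of a diagram with at most `N` rows, i.e. the first-column
hook lengths of the diagram padded to `N` rows): the hook lengths `h(i, j)`, `j < λ_i`, of row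
`i` together with the differences `β_i - β_s`, `i < s < N`, form a permutation of `1, …, β_i`;
hence `(∏_{j < λ_i} h(i, j)) · ∏_{i < s < N} (β_i - β_s) = β_i!`.
[cite: FrameRobinsonThrallCJM1954, Lemma 1 and (2.1)] -/
theorem prod_hookLength_row_mul_prod_sub (hN : ∀ c ∈ Y.cells, c.1 < N) {i : ℕ} (hi : i < N) :
    (∏ j ∈ Finset.range (Y.rowLen i), hookLength Y (i, j)) *
        ∏ s ∈ Finset.Ioo i N, (Y.rowLen i + (N - 1 - i) - (Y.rowLen s + (N - 1 - s))) =
      (Y.rowLen i + (N - 1 - i)).factorial := by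
  classical
  set b := Y.rowLen i + (N - 1 - i) with hb
  have hcol : ∀ j, Y.colLen j ≤ N := colLen_le_of_forall_fst_lt hN
  have hhook : ∀ j, hookLength Y (i, j) = Y.rowLen i - j + (Y.colLen j - i) - 1 := fun j => rfl
  have hmemrow : ∀ j, j < Y.rowLen i → i < Y.colLen j := fun j hj =>
    YoungDiagram.mem_iff_lt_colLen.1 (YoungDiagram.mem_iff_lt_rowLen.2 hj)
  set f : ℕ → ℕ := fun j => hookLength Y (i, j) with hf
  set g : ℕ → ℕ := fun s => b - (Y.rowLen s + (N - 1 - s)) with hg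
  have hfinj : Set.InjOn f (Finset.range (Y.rowLen i)) := by
    intro j₁ hj₁ j₂ hj₂ h
    rw [Finset.coe_range, Set.mem_Iio] at hj₁ hj₂
    simp only [hf, hhook] at h
    have h₁ := hmemrow j₁ hj₁
    have h₂ := hmemrow j₂ hj₂
    by_contra hne
    rcases Nat.lt_or_gt_of_ne hne with hlt | hlt
    · have := Y.colLen_anti j₁ j₂ hlt.le
      omega
    · have := Y.colLen_anti j₂ j₁ hlt.le
      omega
  have hginj : Set.InjOn g (Finset.Ioo i N) := by
    intro s₁ hs₁ s₂ hs₂ h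
    rw [Finset.coe_Ioo, Set.mem_Ioo] at hs₁ hs₂
    simp only [hg, hb] at h
    have a₁ := Y.rowLen_anti i s₁ hs₁.1.le
    have a₂ := Y.rowLen_anti i s₂ hs₂.1.le
    by_contra hne
    rcases Nat.lt_or_gt_of_ne hne with hlt | hlt
    · have := Y.rowLen_anti s₁ s₂ hlt.le
      omega
    · have := Y.rowLen_anti s₂ s₁ hlt.le
      omega
  have hdisj : Disjoint ((Finset.range (Y.rowLen i)).image f) ((Finset.Ioo i N).image g) := by
    rw [Finset.disjoint_left]
    intro v hv₁ hv₂
    obtain ⟨j, hj, rfl⟩ := Finset.mem_image.1 hv₁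
    obtain ⟨s, hs, hfs⟩ := Finset.mem_image.1 hv₂
    rw [Finset.mem_range] at hj
    rw [Finset.mem_Ioo] at hs
    simp only [hf, hg, hhook, hb] at hfs
    have h₁ := hmemrow j hj
    have h₂ := Y.rowLen_anti i s hs.1.le
    have h₃ := hcol j
    by_cases hsj : (s, j) ∈ Y
    · have t₁ := YoungDiagram.mem_iff_lt_rowLen.1 hsj
      have t₂ := YoungDiagram.mem_iff_lt_colLen.1 hsj
      omega
    · have t₁ : ¬ j < Y.rowLen s := fun h => hsj (YoungDiagram.mem_iff_lt_rowLen.2 h)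
      have t₂ : ¬ s < Y.colLen j := fun h => hsj (YoungDiagram.mem_iff_lt_colLen.2 h)
      omega
  have hsub : (Finset.range (Y.rowLen i)).image f ∪ (Finset.Ioo i N).image g ⊆
      Finset.Ico 1 (b + 1) := by
    intro v hv
    rw [Finset.mem_Ico]
    rcases Finset.mem_union.1 hv with hv | hv
    · obtain ⟨j, hj, rfl⟩ := Finset.mem_image.1 hv
      rw [Finset.mem_range] at hj
      have h₁ := hmemrow j hj
      have h₃ := hcol j
      simp only [hf, hhook, hb]
      omega
    · obtain ⟨s, hs, rfl⟩ := Finset.mem_image.1 hv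
      rw [Finset.mem_Ioo] at hs
      have h₂ := Y.rowLen_anti i s hs.1.le
      simp only [hg, hb]
      omega
  have hcard : (Finset.Ico 1 (b + 1)).card ≤
      ((Finset.range (Y.rowLen i)).image f ∪ (Finset.Ioo i N).image g).card := by
    rw [Finset.card_union_of_disjoint hdisj, Finset.card_image_of_injOn hfinj,
      Finset.card_image_of_injOn hginj, Finset.card_range, Nat.card_Ioo, Nat.card_Ico]
    omega
  have heq := Finset.eq_of_subset_of_card_le hsub hcard
  calc (∏ j ∈ Finset.range (Y.rowLen i), hookLength Y (i, j)) *
        ∏ s ∈ Finset.Ioo i N, (b - (Y.rowLen s + (N - 1 - s)))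
      = (∏ v ∈ (Finset.range (Y.rowLen i)).image f, v) *
          ∏ v ∈ (Finset.Ioo i N).image g, v := by
        rw [Finset.prod_image hfinj, Finset.prod_image hginj]
    _ = ∏ v ∈ Finset.Ico 1 (b + 1), v := by rw [← Finset.prod_union hdisj, heq]
    _ = b.factorial := Finset.prod_Ico_id_eq_factorial b

/-- **Frame–Robinson–Thrall (2.1), product over the rows**: for a Young diagram with all rows
`< N` and `β_i = λ_i + (N - 1 - i)`,
`(∏_{c ∈ Y} h(c)) · ∏_{i < s < N} (β_i - β_s) = ∏_{i < N} β_i!`.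
[cite: FrameRobinsonThrallCJM1954, (2.1)–(2.3)] -/
theorem prod_hookLength_mul_prod_prod_sub (hN : ∀ c ∈ Y.cells, c.1 < N) :
    (∏ c ∈ Y.cells, hookLength Y c) *
        ∏ i ∈ Finset.range N, ∏ s ∈ Finset.Ioo i N,
          (Y.rowLen i + (N - 1 - i) - (Y.rowLen s + (N - 1 - s))) =
      ∏ i ∈ Finset.range N, (Y.rowLen i + (N - 1 - i)).factorial := by
  rw [prod_cells_eq_prod_range_rowLen hN, ← Finset.prod_mul_distrib]
  exact Finset.prod_congr rfl fun i hi =>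
    prod_hookLength_row_mul_prod_sub hN (Finset.mem_range.1 hi)

/-- The `β`-numbers `β_i = λ_i + (N - 1 - i)` of a diagram strictly decrease on `i < N`.
[folklore] -/
theorem rowLen_add_lt_rowLen_add (Y : YoungDiagram) {i s N : ℕ} (his : i < s) (hs : s < N) :
    Y.rowLen s + (N - 1 - s) < Y.rowLen i + (N - 1 - i) := by
  have := Y.rowLen_anti i s his.le
  omega

end RowHooks

section Branching

variable {Y : YoungDiagram} {m N : ℕ}

/-- There is no standard filling by more entries than cells. [folklore] -/
theorem card_stdFilling_eq_zero_of_card_lt (h : Y.cells.card < m) :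
    Nat.card (StdFilling m Y) = 0 := by
  rw [Nat.card_eq_zero]
  refine Or.inl ⟨fun T => ?_⟩
  have := Fintype.card_le_of_injective
    (fun p : Fin m => (⟨T.1 p, (YoungDiagram.mem_cells _).2 (T.mem p)⟩ : Y.cells))
    (fun p q hpq => T.injective (congrArg Subtype.val hpq))
  simp only [Fintype.card_fin, Fintype.card_coe] at this
  omega

/-- **Branching rule over the corners.** For a Young diagram `Y` with `m + 1` cells, all in rows
`< N`: `#SYT(Y) = ∑_{r : λ_{r+1} < λ_r} #SYT(Y ∖ corner_r)`, the sum over the rows `r < N`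
ending in a corner `(r, λ_r - 1)`; the other cells `c` of the general branching sum
`StdFilling.card_stdFilling_succ` have `|Y ⊖ c| < m` and contribute nothing.
Fulton, *Young Tableaux*, §7.2; James, LNM 682, 9.2; FRT 1954, proof of Cor. 1 ("standard
orderings"). [folklore] -/
theorem card_stdFilling_succ_eq_sum_corners (hY : Y.cells.card = m + 1)
    (hN : ∀ c ∈ Y.cells, c.1 < N) :
    Nat.card (StdFilling (m + 1) Y) =
      ∑ r ∈ (Finset.range N).filter (fun r => Y.rowLen (r + 1) < Y.rowLen r),
        Nat.card (StdFilling m (Y.removeAbove (r, Y.rowLen r - 1))) := by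
  classical
  rw [StdFilling.card_stdFilling_succ]
  set C := (Finset.range N).filter (fun r => Y.rowLen (r + 1) < Y.rowLen r) with hC
  have hinj : Set.InjOn (fun r : ℕ => (r, Y.rowLen r - 1)) C :=
    fun r₁ _ r₂ _ h => (Prod.ext_iff.1 h).1
  have himage : ∑ c ∈ C.image (fun r => (r, Y.rowLen r - 1)),
      Nat.card (StdFilling m (Y.removeAbove c)) =
        ∑ r ∈ C, Nat.card (StdFilling m (Y.removeAbove (r, Y.rowLen r - 1))) :=
    Finset.sum_image hinj
  rw [← himage]
  symm
  apply Finset.sum_subset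
  · intro c hc
    obtain ⟨r, hr, rfl⟩ := Finset.mem_image.1 hc
    have hr' := (Finset.mem_filter.1 hr).2
    exact (YoungDiagram.mem_cells _).2 (YoungDiagram.mem_iff_lt_rowLen.2 (by omega))
  · intro c hc hnot
    apply card_stdFilling_eq_zero_of_card_lt
    obtain ⟨i, j⟩ := c
    have hcY := (YoungDiagram.mem_cells _).1 hc
    have hj : j < Y.rowLen i := YoungDiagram.mem_iff_lt_rowLen.1 hcY
    have hi : i < N := hN _ hc
    obtain ⟨c', hc'Y, hcc', hne⟩ :
        ∃ c' : ℕ × ℕ, c' ∈ Y.cells ∧ ((i, j) : ℕ × ℕ) ≤ c' ∧ c' ≠ (i, j) := by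
      by_cases hj1 : j + 1 < Y.rowLen i
      · refine ⟨(i, j + 1), (YoungDiagram.mem_cells _).2 (YoungDiagram.mem_iff_lt_rowLen.2 hj1),
          Prod.mk_le_mk.2 ⟨le_rfl, Nat.le_succ j⟩, fun h => ?_⟩
        have := (Prod.ext_iff.1 h).2
        simp only at this
        omega
      · have hjeq : j = Y.rowLen i - 1 := by omega
        by_cases hcorner : Y.rowLen (i + 1) < Y.rowLen i
        · exact absurd (Finset.mem_image.2 ⟨i, Finset.mem_filter.2
            ⟨Finset.mem_range.2 hi, hcorner⟩, by rw [hjeq]⟩) hnot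
        · refine ⟨(i + 1, j), (YoungDiagram.mem_cells _).2
            (YoungDiagram.mem_iff_lt_rowLen.2 (by omega)),
            Prod.mk_le_mk.2 ⟨Nat.le_succ i, le_rfl⟩, fun h => ?_⟩
          have := (Prod.ext_iff.1 h).1
          simp only at this
          omega
    have htwo : 2 ≤ Y.cells.card := by
      calc 2 = ({((i, j) : ℕ × ℕ), c'} : Finset (ℕ × ℕ)).card := by
            rw [Finset.card_pair hne.symm]
        _ ≤ Y.cells.card := Finset.card_le_card (by
            intro x hx
            simp only [Finset.mem_insert, Finset.mem_singleton] at hx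
            rcases hx with rfl | rfl
            · exact hc
            · exact hc'Y)
    calc (Y.removeAbove (i, j)).cells.card ≤ ((Y.cells.erase (i, j)).erase c').card := by
          apply Finset.card_le_card
          intro x hx
          rw [YoungDiagram.removeAbove_cells, Finset.mem_filter] at hx
          rw [Finset.mem_erase, Finset.mem_erase]
          exact ⟨fun h => hx.2 (h ▸ hcc'), fun h => hx.2 (h ▸ le_rfl), hx.1⟩
      _ < m := by
          rw [Finset.card_erase_of_mem (Finset.mem_erase.2 ⟨hne, hc'Y⟩),
            Finset.card_erase_of_mem hc, hY]
          omega

end Branching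


section HookFormula

open YoungDiagram

variable {Y : YoungDiagram} {N : ℕ}

/-- Casting the `ℕ`-valued discriminant `∏_{i < s < N} (β_i - β_s)` of the `β`-numbers to
`ℚ` (no truncation: `β` is strictly decreasing). [folklore] -/
theorem cast_prod_prod_rowLen_add_sub (Y : YoungDiagram) (N : ℕ) :
    ((∏ i ∈ Finset.range N, ∏ s ∈ Finset.Ioo i N,
        (Y.rowLen i + (N - 1 - i) - (Y.rowLen s + (N - 1 - s))) : ℕ) : ℚ) =
      ∏ i ∈ Finset.range N, ∏ s ∈ Finset.Ioo i N,
        (((Y.rowLen i + (N - 1 - i) : ℕ) : ℚ) - ((Y.rowLen s + (N - 1 - s) : ℕ) : ℚ)) := by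
  rw [Nat.cast_prod]
  refine Finset.prod_congr rfl fun i _ => ?_
  rw [Nat.cast_prod]
  refine Finset.prod_congr rfl fun s hs => ?_
  rw [Finset.mem_Ioo] at hs
  rw [Nat.cast_sub (rowLen_add_lt_rowLen_add Y hs.1 hs.2).le]

/-- The `β`-numbers, cast to `ℚ`, are injective on `i < N`. [folklore] -/
theorem injOn_cast_rowLen_add (Y : YoungDiagram) (N : ℕ) :
    Set.InjOn (fun i => ((Y.rowLen i + (N - 1 - i) : ℕ) : ℚ)) (Finset.range N) := by
  intro i hi s hs h
  rw [Finset.coe_range, Set.mem_Iio] at hi hs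
  dsimp only at h
  have h' : Y.rowLen i + (N - 1 - i) = Y.rowLen s + (N - 1 - s) := by exact_mod_cast h
  by_contra hne
  rcases Nat.lt_or_gt_of_ne hne with hlt | hlt
  · have := rowLen_add_lt_rowLen_add Y hlt hs
    omega
  · have := rowLen_add_lt_rowLen_add Y hlt hi
    omega

/-- **The Frobenius–Young degree formula** (FRT 1954, (2.2), quoted there from Frobenius and
Young; Fulton, *Young Tableaux*, §4.3 Ex. 9–10), for the number of standard Young
tableaux of an arbitrary Young diagram `Y` with `m` cells and all rows `< N`, in terms of the
`β`-numbers `β_i = λ_i + (N - 1 - i)`: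
`#SYT(Y) · ∏_{i < N} β_i! = m! · ∏_{i < s < N} (β_i - β_s)` (an identity in `ℚ`).
Proof: induction on `m` via the branching rule over corners and the identity
`sum_mul_prod_sub_sub_one_div_sub_eq`. [cite: FrameRobinsonThrallCJM1954, (2.2)] -/
theorem card_stdFilling_mul_prod_factorial (N : ℕ) :
    ∀ (m : ℕ) (Y : YoungDiagram), Y.cells.card = m → (∀ c ∈ Y.cells, c.1 < N) →
      (Nat.card (StdFilling m Y) : ℚ) *
          ∏ i ∈ Finset.range N, ((Y.rowLen i + (N - 1 - i)).factorial : ℚ) =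
        (m.factorial : ℚ) * ∏ i ∈ Finset.range N, ∏ s ∈ Finset.Ioo i N,
          (((Y.rowLen i + (N - 1 - i) : ℕ) : ℚ) -
            ((Y.rowLen s + (N - 1 - s) : ℕ) : ℚ)) := by
  intro m
  induction m with
  | zero =>
    intro Y hY hN
    have hB := prod_hookLength_mul_prod_prod_sub hN
    rw [Finset.card_eq_zero.1 hY, Finset.prod_empty, one_mul] at hB
    rw [StdFilling.card_zero, Nat.cast_one, one_mul, Nat.factorial_zero, Nat.cast_one, one_mul,
      ← cast_prod_prod_rowLen_add_sub, hB, Nat.cast_prod]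
  | succ m ih =>
    intro Y hY hN
    set x : ℕ → ℚ := fun i => ((Y.rowLen i + (N - 1 - i) : ℕ) : ℚ) with hx
    have hxinj : Set.InjOn x (Finset.range N) := injOn_cast_rowLen_add Y N
    have hrowN : Y.rowLen N = 0 := YoungDiagram.rowLen_eq_zero_of_forall_lt hN
    rw [card_stdFilling_succ_eq_sum_corners hY hN, Nat.cast_sum, Finset.sum_mul]
    -- the corner terms, by the induction hypothesis
    have hterm : ∀ r ∈ (Finset.range N).filter (fun r => Y.rowLen (r + 1) < Y.rowLen r),
        (Nat.card (StdFilling m (Y.removeAbove (r, Y.rowLen r - 1))) : ℚ) *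
            ∏ i ∈ Finset.range N, ((Y.rowLen i + (N - 1 - i)).factorial : ℚ) =
          (m.factorial : ℚ) *
            (x r * ∏ l ∈ (Finset.range N).erase r, (x r - x l - 1) / (x r - x l)) *
              ∏ i ∈ Finset.range N, ∏ s ∈ Finset.Ioo i N, (x i - x s) := by
      intro r hr
      obtain ⟨hrN, hcorner⟩ := Finset.mem_filter.1 hr
      rw [Finset.mem_range] at hrN
      set Y' := Y.removeAbove (r, Y.rowLen r - 1) with hY'
      have hY'card : Y'.cells.card = m := by
        rw [hY', YoungDiagram.card_removeAbove_corner hcorner, hY, Nat.add_sub_cancel]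
      have hN' : ∀ c ∈ Y'.cells, c.1 < N := fun c hc =>
        hN c ((YoungDiagram.mem_cells _).2
          (YoungDiagram.mem_of_mem_removeAbove ((YoungDiagram.mem_cells _).1 hc)))
      have hrow_self : Y'.rowLen r = Y.rowLen r - 1 :=
        YoungDiagram.rowLen_removeAbove_corner_self hcorner
      have hrow_ne : ∀ i, i ≠ r → Y'.rowLen i = Y.rowLen i := fun i hi =>
        YoungDiagram.rowLen_removeAbove_corner_of_ne hcorner hi
      have hx' : (fun i => ((Y'.rowLen i + (N - 1 - i) : ℕ) : ℚ)) =
          Function.update x r (x r - 1) := by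
        funext i
        by_cases hi : i = r
        · subst hi
          rw [Function.update_self, hrow_self, hx]
          have h1 : Y.rowLen i - 1 + (N - 1 - i) = (Y.rowLen i + (N - 1 - i)) - 1 := by omega
          rw [h1, Nat.cast_sub (by omega), Nat.cast_one]
        · rw [Function.update_of_ne hi, hrow_ne i hi]
      have ih' := ih Y' hY'card hN'
      have hfac : ∏ i ∈ Finset.range N, ((Y.rowLen i + (N - 1 - i)).factorial : ℚ) =
          x r * ∏ i ∈ Finset.range N, ((Y'.rowLen i + (N - 1 - i)).factorial : ℚ) := by
        rw [← Finset.mul_prod_erase _ _ (Finset.mem_range.2 hrN),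
          ← Finset.mul_prod_erase (Finset.range N) _ (Finset.mem_range.2 hrN), ← mul_assoc]
        congr 1
        · have h1 : Y.rowLen r + (N - 1 - r) = (Y.rowLen r - 1 + (N - 1 - r)) + 1 := by omega
          simp only [hrow_self, hx, h1, Nat.factorial_succ]
          push_cast
          ring
        · exact Finset.prod_congr rfl fun i hi => by rw [hrow_ne i (Finset.ne_of_mem_erase hi)]
      have hΦ' : ∏ i ∈ Finset.range N, ∏ s ∈ Finset.Ioo i N,
          (((Y'.rowLen i + (N - 1 - i) : ℕ) : ℚ) - ((Y'.rowLen s + (N - 1 - s) : ℕ) : ℚ)) =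
          (∏ l ∈ (Finset.range N).erase r, (x r - x l - 1) / (x r - x l)) *
            ∏ i ∈ Finset.range N, ∏ s ∈ Finset.Ioo i N, (x i - x s) := by
        have key := prod_prod_update_sub_one_eq x hrN hxinj
        rw [← hx'] at key
        exact key
      calc (Nat.card (StdFilling m Y') : ℚ) *
            ∏ i ∈ Finset.range N, ((Y.rowLen i + (N - 1 - i)).factorial : ℚ)
          = x r * ((Nat.card (StdFilling m Y') : ℚ) *
              ∏ i ∈ Finset.range N, ((Y'.rowLen i + (N - 1 - i)).factorial : ℚ)) := by
            rw [hfac]; ring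
        _ = x r * ((m.factorial : ℚ) *
              ((∏ l ∈ (Finset.range N).erase r, (x r - x l - 1) / (x r - x l)) *
                ∏ i ∈ Finset.range N, ∏ s ∈ Finset.Ioo i N, (x i - x s))) := by
            rw [ih', hΦ']
        _ = _ := by ring
    rw [Finset.sum_congr rfl hterm, ← Finset.sum_mul, ← Finset.mul_sum]
    -- non-corner rows contribute vanishing terms
    have hext : ∑ r ∈ (Finset.range N).filter (fun r => Y.rowLen (r + 1) < Y.rowLen r),
        x r * ∏ l ∈ (Finset.range N).erase r, (x r - x l - 1) / (x r - x l) =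
        ∑ r ∈ Finset.range N,
          x r * ∏ l ∈ (Finset.range N).erase r, (x r - x l - 1) / (x r - x l) := by
      apply Finset.sum_subset (Finset.filter_subset _ _)
      intro r hr hnot
      rw [Finset.mem_range] at hr
      have hle : Y.rowLen r ≤ Y.rowLen (r + 1) := by
        by_contra h
        exact hnot (Finset.mem_filter.2 ⟨Finset.mem_range.2 hr, not_le.1 h⟩)
      have heq : Y.rowLen r = Y.rowLen (r + 1) :=
        le_antisymm hle (Y.rowLen_anti r (r + 1) (Nat.le_succ r))
      by_cases hr1 : r + 1 < N
      · have hmem : r + 1 ∈ (Finset.range N).erase r :=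
          Finset.mem_erase.2 ⟨by omega, Finset.mem_range.2 hr1⟩
        rw [Finset.prod_eq_zero hmem, mul_zero]
        have h1 : Y.rowLen r + (N - 1 - r) = (Y.rowLen (r + 1) + (N - 1 - (r + 1))) + 1 := by
          omega
        simp only [hx, h1]
        push_cast
        ring
      · have hrN : r + 1 = N := by omega
        have h0 : Y.rowLen r + (N - 1 - r) = 0 := by
          rw [heq, hrN, hrowN]
          omega
        simp only [hx, h0, Nat.cast_zero, zero_mul]
    rw [hext, sum_mul_prod_sub_sub_one_div_sub_eq _ x hxinj, Finset.card_range]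
    -- `∑ β_r = |Y| + (N choose 2)`
    have hsumx :
        ∑ r ∈ Finset.range N, x r = (Y.cells.card : ℚ) + ((N.choose 2 : ℕ) : ℚ) := by
      rw [card_cells_eq_sum_range_rowLen hN, hx]
      push_cast
      rw [Finset.sum_add_distrib]
      congr 1
      rw [Finset.sum_range_reflect (fun r => ((r : ℕ) : ℚ)) N, ← Nat.cast_sum,
        Finset.sum_range_id, Nat.choose_two_right]
    rw [hsumx, hY, Nat.factorial_succ]
    simp only [hx]
    push_cast
    ring

/-- **The hook length formula for Young diagrams** (Frame–Robinson–Thrall 1954, Theorem 1, in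
division-free form): for every Young diagram `Y` with `m` cells, the number of standard Young
tableaux of shape `Y` times the product of the hook lengths is `m!`.
Proof: `#SYT · ∏ β_i! = m! · Φ(β)` (`card_stdFilling_mul_prod_factorial`) and
`H · Φ(β) = ∏ β_i!` (`prod_hookLength_mul_prod_prod_sub`), and `Φ(β) ≠ 0`.
[cite: FrameRobinsonThrallCJM1954, Theorem 1] -/
theorem card_stdFilling_mul_prod_hookLength (Y : YoungDiagram) {m : ℕ} (hY : Y.cells.card = m) :
    Nat.card (StdFilling m Y) * ∏ c ∈ Y.cells, hookLength Y c = m.factorial := by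
  set N := Y.colLen 0 with hNdef
  have hN : ∀ c ∈ Y.cells, c.1 < N := by
    rintro ⟨i, j⟩ hc
    exact YoungDiagram.mem_iff_lt_colLen.1
      (Y.up_left_mem le_rfl (Nat.zero_le j) ((YoungDiagram.mem_cells _).1 hc))
  have hA := card_stdFilling_mul_prod_factorial N m Y hY hN
  have hB := prod_hookLength_mul_prod_prod_sub hN
  have hB' : ((∏ c ∈ Y.cells, hookLength Y c : ℕ) : ℚ) *
      ∏ i ∈ Finset.range N, ∏ s ∈ Finset.Ioo i N,
        (((Y.rowLen i + (N - 1 - i) : ℕ) : ℚ) - ((Y.rowLen s + (N - 1 - s) : ℕ) : ℚ)) =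
      ∏ i ∈ Finset.range N, ((Y.rowLen i + (N - 1 - i)).factorial : ℚ) := by
    rw [← cast_prod_prod_rowLen_add_sub, ← Nat.cast_mul, hB, Nat.cast_prod]
  have hΦ : ∏ i ∈ Finset.range N, ∏ s ∈ Finset.Ioo i N,
      (((Y.rowLen i + (N - 1 - i) : ℕ) : ℚ) -
        ((Y.rowLen s + (N - 1 - s) : ℕ) : ℚ)) ≠ 0 := by
    rw [Finset.prod_ne_zero_iff]
    intro i hi
    rw [Finset.prod_ne_zero_iff]
    intro s hs
    rw [Finset.mem_Ioo] at hs
    apply sub_ne_zero.2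
    have := rowLen_add_lt_rowLen_add Y hs.1 hs.2
    exact_mod_cast this.ne'
  have key : ((Nat.card (StdFilling m Y) * ∏ c ∈ Y.cells, hookLength Y c : ℕ) : ℚ) *
      ∏ i ∈ Finset.range N, ∏ s ∈ Finset.Ioo i N,
        (((Y.rowLen i + (N - 1 - i) : ℕ) : ℚ) - ((Y.rowLen s + (N - 1 - s) : ℕ) : ℚ)) =
      (m.factorial : ℚ) * ∏ i ∈ Finset.range N, ∏ s ∈ Finset.Ioo i N,
        (((Y.rowLen i + (N - 1 - i) : ℕ) : ℚ) - ((Y.rowLen s + (N - 1 - s) : ℕ) : ℚ)) := by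
    rw [Nat.cast_mul, mul_assoc, hB', hA]
  exact_mod_cast mul_right_cancel₀ hΦ key

variable {d : ℕ}

/-- **Discharge of `numStandardTableaux_mul_prod_hookLength`: the hook length formula**
(Frame–Robinson–Thrall, Canad. J. Math. 6 (1954), Theorem 1 (2.4), `f_λ = n!/H_λ`), in the
division-free form `f^μ · ∏_{c ∈ μ} h(c) = d!` for every partition `μ ⊢ d`, with `f^μ` the
number of standard Young tableaux of shape `μ` (FRT, proof of Cor. 1: the degree is the number of
standard orderings). From `card_stdFilling_mul_prod_hookLength` via
`numStandardTableaux_eq_card_stdFilling`. [cite: FrameRobinsonThrallCJM1954, Theorem 1] -/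
theorem numStandardTableaux_mul_prod_hookLength_holds :
    numStandardTableaux_mul_prod_hookLength (d := d) := by
  intro μ
  rw [numStandardTableaux_eq_card_stdFilling]
  exact card_stdFilling_mul_prod_hookLength _ μ.card_cells_youngDiagram

end HookFormula

end Literature.NumberTheory.DiophantineGeometry
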